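import Summits.CriticalPhenomena.PercolationContinuityZ3.Theorems.SahiMasterFamilyUCBernsteinNested

/-!
# The permutation partition function in DEFECT variables `A(f) = Σ_σ ∏_{c ∈ cyc σ} (1 − E ∏_{i∈c} f_i)`: the shifted model,
# its block expansion along the cycle through a fixed index, re-indexing, and the convolution identity `(1 − Σ t)·exp(C_1) = 1`

Unit `prim-masterthm-p4` (gen 27; crux anchor stmt-CriticalPhenomena-4575, helper work; memo
`run/shared/lean/prim/prim-masterthm/prim-masterthm-p4/P4-GEN27-REPORT.md` §1).  Toolkit for `…ComplementForm` (the complement form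
`Φ = Σ_z W^{(z)} − A` of Lieb–Sahi's cycle sum and the cap identity at every root, every finite index type).
* `badSum μ f = Σ_{σ ∈ Sym κ} ∏_{c ∈ cyc σ} (1 − E_μ(∏_{i∈c} f_i))` on an arbitrary finite index type `κ` (for a two-family mixture the
  factors are the bad-cycle weights `w[c ∉ 𝒰] + (1−w)[c ∉ 𝒱]`, whence the name); `= 1` on an empty index type.
* SHIFTED MODEL (`shiftW`, `shiftF`): one extra point of weight `−1` on which every function is `1`; every mixed moment drops by
  one (`ex_shift`), so **`A(f) = −(Lieb–Sahi cycle sum of the shifted model)`** (`badSum_eq_neg_cycleSum`) and the printed block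
  expansion [LiebSahi2021, Prop. 3.4] (`CycleForm.cycleSum_eq_sum_blocks`, at ANY root) gives
  **`A(f) = Σ_{B ∋ i} (|B|−1)!·(1 − E ∏_{j∈B} f_j)·A(f|_{Bᶜ})`** (`badSum_eq_sum_blocks`).
* re-indexing invariance (`badSum_comp_equiv`), the set function `badOn μ f R = A(f|_R)` and its transport lemmas
  (`badSum_notMem_eq_badOn`, `badSum_ne_eq_badOn`, `badOn_restrict`, `badOn_univ`, `badOn_empty`).
* the arithmetical identity **`Σ_{Q ⊆ K} |Q|!·(x(K∖Q) − Σ_{z ∈ K∖Q} x(K∖Q∖z)) = x(K)`** for every set function `x`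
  (`sum_powerset_factorial_sub`; `(1 − Σ_i t_i)·Σ_R |R|! t^R = 1` in the square-free algebra) — the form in which the cap identity
  is consumed by the induction of `…ComplementForm`.
HONEST FRAMING: definitions and identities; nothing here is specific to union-closed families; conjecture (B), Sahi's `C_k` and the
master theorem remain OPEN.  Axioms standard. [this work]
-/

noncomputable section

open scoped Classical

namespace Summit.CriticalPhenomena.PercolationContinuityZ3.Theorems

namespace ComplementForm

open Finset Function Equiv
open Literature.Combinatorics.Sahi2008
open Literature.Combinatorics.Sahi2008.CycleForm

variable {α : Type*} [Fintype α]

section General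

variable {κ : Type*} [Fintype κ] [DecidableEq κ]

/-! ### The permutation partition function in defect variables -/

/-- `A(f) := Σ_{σ ∈ Sym κ} ∏_{c ∈ cyc σ} (1 − E(∏_{i ∈ c} f_i))` — the permutation partition function of the family `f` in the
DEFECT variables `1 − E(∏_{i∈c} f_i)` (for a two-family mixture these are the weights `w[c ∉ 𝒰] + (1−w)[c ∉ 𝒱]` of BAD cycles,
whence the name). [this work] -/
def badSum (μ : α → ℝ) (f : κ → α → ℝ) : ℝ :=
  ∑ σ : Perm κ, ∏ B ∈ orbits σ, (1 - ex μ (fun x => ∏ i ∈ B, f i x))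

/-- On an empty index type `A = 1` (one permutation, no cycles). [this work] -/
theorem badSum_of_isEmpty [IsEmpty κ] (μ : α → ℝ) (f : κ → α → ℝ) : badSum μ f = 1 := by
  unfold badSum
  have h1 : ∀ σ : Perm κ, orbits σ = ∅ := fun σ => by
    unfold orbits; rw [Finset.univ_eq_empty, image_empty]
  simp only [h1, prod_empty, sum_const, card_univ]
  rw [Fintype.card_eq_one_iff.2 ⟨1, fun σ => Subsingleton.elim _ _⟩]
  simp

/-! ### The shifted model: all moments lowered by one -/

/-- The signed weight of the SHIFTED model: the old space plus one extra point of weight `−1`. [this work] -/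
def shiftW (μ : α → ℝ) : α ⊕ Unit → ℝ := Sum.elim μ (fun _ => -1)

/-- The functions of the shifted model: the old functions, extended by `1` at the extra point. [this work] -/
def shiftF (f : κ → α → ℝ) (i : κ) : α ⊕ Unit → ℝ := Sum.elim (f i) (fun _ => 1)

omit [Fintype κ] [DecidableEq κ] in
/-- Every mixed moment drops by exactly one in the shifted model: `E'(∏_{i∈B} f'_i) = E(∏_{i∈B} f_i) − 1`. [this work] -/
theorem ex_shift (μ : α → ℝ) (f : κ → α → ℝ) (B : Finset κ) :
    ex (shiftW μ) (fun x => ∏ i ∈ B, shiftF f i x) = ex μ (fun x => ∏ i ∈ B, f i x) - 1 := by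
  rw [ex_def, ex_def, Fintype.sum_sum_type]
  simp [shiftW, shiftF]
  ring

/-- `E'_σ = ∏_c (E(∏ f) − 1)` in the shifted model. [this work] -/
theorem cycleE_shift (μ : α → ℝ) (f : κ → α → ℝ) (σ : Perm κ) :
    cycleE (shiftW μ) (shiftF f) σ = ∏ B ∈ orbits σ, (ex μ (fun x => ∏ i ∈ B, f i x) - 1) := by
  unfold cycleE
  exact prod_congr rfl fun B _ => ex_shift μ f B

omit [Fintype α] [Fintype κ] [DecidableEq κ] in
/-- Restricting the shifted functions to a sub-index-type is shifting the restricted functions. [this work] -/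
theorem shiftF_restrict {κ' : Type*} (g : κ' → κ) (f : κ → α → ℝ) :
    (fun j => shiftF f (g j)) = shiftF (fun j => f (g j)) := rfl

/-- A nonempty index type carries at least one cycle. [folklore] -/
theorem card_orbits_pos [Nonempty κ] (σ : Perm κ) : 0 < (orbits σ).card :=
  card_pos.2 ⟨_, orbit_mem_orbits σ (Classical.arbitrary κ)⟩

/-- **`A(f) = −Φ(shifted model)`** on a nonempty index type (`∏_c (1 − e_c) = −(−1)^{C−1} ∏_c (e_c − 1)`). [this work] -/
theorem badSum_eq_neg_cycleSum [Nonempty κ] (μ : α → ℝ) (f : κ → α → ℝ) :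
    badSum μ f = -cycleSum (shiftW μ) (shiftF f) := by
  unfold badSum cycleSum
  rw [← sum_neg_distrib]
  refine sum_congr rfl fun σ _ => ?_
  rw [cycleE_shift]
  have e1 : ∏ B ∈ orbits σ, (1 - ex μ (fun x => ∏ i ∈ B, f i x)) =
      ∏ B ∈ orbits σ, ((-1) * (ex μ (fun x => ∏ i ∈ B, f i x) - 1)) :=
    prod_congr rfl fun B _ => by ring
  have h2 : ((-1 : ℝ)) ^ (orbits σ).card = -((-1) ^ ((orbits σ).card - 1)) := by
    obtain ⟨m, hm⟩ : ∃ m, (orbits σ).card = m + 1 := ⟨_, (Nat.succ_pred_eq_of_pos (card_orbits_pos σ)).symm⟩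
    rw [hm, pow_succ, Nat.add_sub_cancel]; ring
  rw [e1, prod_mul_distrib, prod_const, h2]
  ring

/-- **Block expansion of `A` along the cycle through a fixed index `i`** (Lieb–Sahi's Prop. 3.4 for the shifted model):
`A(f) = Σ_{B ∋ i} (|B|−1)!·(1 − E ∏_{j∈B} f_j)·A(f|_{Bᶜ})`. [this work] -/
theorem badSum_eq_sum_blocks (μ : α → ℝ) (f : κ → α → ℝ) (i : κ) :
    badSum μ f = ∑ B ∈ univ.filter (fun B : Finset κ => i ∈ B),
      ((B.card - 1).factorial : ℝ) * ((1 - ex μ (fun x => ∏ j ∈ B, f j x)) *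
        badSum μ (fun j : {x // x ∉ B} => f j)) := by
  haveI : Nonempty κ := ⟨i⟩
  rw [badSum_eq_neg_cycleSum, cycleSum_eq_sum_blocks (shiftW μ) (shiftF f) i, ← sum_neg_distrib]
  refine sum_congr rfl fun B _ => ?_
  rw [ex_shift]
  by_cases hBu : B = univ
  · subst hBu
    haveI : IsEmpty {x // x ∉ (univ : Finset κ)} := ⟨fun x => x.2 (mem_univ _)⟩
    rw [coRest_univ, badSum_of_isEmpty]
    ring
  · haveI : Nonempty {x // x ∉ B} := by
      obtain ⟨y, hy⟩ : ∃ y, y ∉ B := not_forall.1 (mt eq_univ_iff_forall.2 hBu)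
      exact ⟨⟨y, hy⟩⟩
    rw [coRest_of_ne_univ _ _ hBu, shiftF_restrict, ← badSum_eq_neg_cycleSum]
    ring

/-! ### Re-indexing invariance and the set-function `A(f|_R)` -/

variable {κ' : Type*} [Fintype κ'] [DecidableEq κ']

/-- Re-indexing invariance: `A(f ∘ e) = A(f)` for a bijection `e` of index types. [this work] -/
theorem badSum_comp_equiv (μ : α → ℝ) (e : κ ≃ κ') (f : κ' → α → ℝ) :
    badSum μ (fun j => f (e j)) = badSum μ f := by
  unfold badSum
  refine Fintype.sum_equiv e.permCongr _ _ fun σ => ?_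
  rw [orbits_permCongr, prod_image fun O₁ _ O₂ _ h => map_injective e.toEmbedding h]
  refine prod_congr rfl fun O _ => ?_
  congr 2
  funext x
  rw [prod_map]
  rfl

/-- `A` of the sub-family indexed by a finite SET `R` of indices. [this work] -/
def badOn (μ : α → ℝ) (f : κ → α → ℝ) (R : Finset κ) : ℝ :=
  badSum μ (fun j : {x // x ∈ R} => f j)

omit [Fintype κ] [DecidableEq κ] [Fintype κ'] [DecidableEq κ'] in
/-- Sub-families along pointwise-equivalent predicates have the same `A` (instances arbitrary). [this work] -/
theorem badSum_subtype_congr (μ : α → ℝ) (f : κ → α → ℝ) {p q : κ → Prop}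
    [Fintype {x // p x}] [DecidableEq {x // p x}] [Fintype {x // q x}] [DecidableEq {x // q x}]
    (h : ∀ x, p x ↔ q x) :
    badSum μ (fun j : {x // p x} => f j) = badSum μ (fun j : {x // q x} => f j) := by
  rw [← badSum_comp_equiv μ (Equiv.subtypeEquivRight h) (fun j : {x // q x} => f j)]
  rfl

/-- The complement sub-family is `A` on the complement set. [this work] -/
theorem badSum_notMem_eq_badOn (μ : α → ℝ) (f : κ → α → ℝ) (B : Finset κ) :
    badSum μ (fun j : {x // x ∉ B} => f j) = badOn μ f (univ \ B) := by
  unfold badOn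
  exact badSum_subtype_congr μ f fun x => by simp

/-- The punctured sub-family is `A` on the punctured set. [this work] -/
theorem badSum_ne_eq_badOn (μ : α → ℝ) (f : κ → α → ℝ) (z : κ) :
    badSum μ (fun j : {x // x ≠ z} => f j) = badOn μ f (univ.erase z) := by
  unfold badOn
  exact badSum_subtype_congr μ f fun x => by simp

/-- The whole family: `A(f|_univ) = A(f)`. [this work] -/
theorem badOn_univ (μ : α → ℝ) (f : κ → α → ℝ) : badOn μ f univ = badSum μ f := by
  unfold badOn
  rw [← badSum_comp_equiv μ (Equiv.subtypeUnivEquiv mem_univ).symm]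
  rfl

omit [Fintype κ] in
/-- `A` on the empty set is `1`. [this work] -/
theorem badOn_empty (μ : α → ℝ) (f : κ → α → ℝ) : badOn μ f ∅ = 1 := by
  unfold badOn
  haveI : IsEmpty {x // x ∈ (∅ : Finset κ)} := ⟨fun x => notMem_empty _ x.2⟩
  exact badSum_of_isEmpty μ _

omit [Fintype κ] in
/-- `A` of a sub-sub-family is `A` of the corresponding sub-family (sets of a subtype pushed forward). [this work] -/
theorem badOn_restrict (μ : α → ℝ) (f : κ → α → ℝ) (p : κ → Prop) (R : Finset {x // p x}) :
    badOn μ (fun j : {x // p x} => f j) R = badOn μ f (R.map (Embedding.subtype p)) := by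
  unfold badOn
  let e : {y : {x // p x} // y ∈ R} ≃ {x : κ // x ∈ R.map (Embedding.subtype p)} :=
    { toFun := fun y => ⟨y.1.1, mem_map.2 ⟨y.1, y.2, rfl⟩⟩
      invFun := fun x => ⟨⟨x.1, property_of_mem_map_subtype R x.2⟩, by
        obtain ⟨y, hy, hyx⟩ := mem_map.1 x.2
        have : y = ⟨x.1, property_of_mem_map_subtype R x.2⟩ := Subtype.ext (by simpa using hyx)
        rw [← this]; exact hy⟩
      left_inv := fun y => rfl
      right_inv := fun x => rfl }
  rw [← badSum_comp_equiv μ e.symm]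
  rfl

omit [Fintype κ] [DecidableEq κ] in
/-- Moments of a block of a subtype are moments of its push-forward. [this work] -/
theorem ex_prod_subtype (μ : α → ℝ) (f : κ → α → ℝ) (p : κ → Prop) (B : Finset {x // p x}) :
    ex μ (fun x => ∏ j ∈ B, f (j : κ) x) = ex μ (fun x => ∏ j ∈ B.map (Embedding.subtype p), f j x) := by
  congr 1
  funext x
  rw [prod_map]
  rfl

/-! ### The elementary convolution identity `(1 − Σ_i t_i)·exp(C_1) = 1` -/

omit [Fintype α] [Fintype κ] in
/-- Re-indexing the subsets not containing `z` by inserting `z`. [folklore] -/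
theorem sum_powerset_erase_insert (K : Finset κ) {z : κ} (hz : z ∈ K) (F : Finset κ → ℝ) :
    ∑ Q ∈ (K.erase z).powerset, F (insert z Q) = ∑ Q ∈ K.powerset.filter (fun Q => z ∈ Q), F Q := by
  rw [← sum_image (f := F) (s := (K.erase z).powerset) (g := insert z)]
  · refine sum_congr ?_ fun _ _ => rfl
    ext Q
    simp only [mem_image, mem_powerset, mem_filter]
    constructor
    · rintro ⟨Q₀, hQ₀, rfl⟩
      refine ⟨?_, mem_insert_self _ _⟩
      exact insert_subset hz (hQ₀.trans (erase_subset _ _))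
    · rintro ⟨hQK, hzQ⟩
      refine ⟨Q.erase z, ?_, insert_erase hzQ⟩
      exact fun x hx => mem_erase.2 ⟨(mem_erase.1 hx).1, hQK (mem_erase.1 hx).2⟩
  · intro Q₁ hQ₁ Q₂ hQ₂ h
    have hz1 : z ∉ Q₁ := fun hz1 => (mem_erase.1 (mem_powerset.1 hQ₁ hz1)).1 rfl
    have hz2 : z ∉ Q₂ := fun hz2 => (mem_erase.1 (mem_powerset.1 hQ₂ hz2)).1 rfl
    rw [← erase_insert hz1, h, erase_insert hz2]

omit [Fintype α] [Fintype κ] in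
/-- **`Σ_{Q ⊆ K} |Q|!·(x(K∖Q) − Σ_{z ∈ K∖Q} x(K∖Q∖z)) = x(K)`** for every set function `x` — the identity
`(1 − Σ_i t_i)·Σ_R |R|! t^R = 1` of the square-free algebra, read coefficientwise against `x`. [folklore] -/
theorem sum_powerset_factorial_sub (x : Finset κ → ℝ) (K : Finset κ) :
    ∑ Q ∈ K.powerset, ((Q.card).factorial : ℝ) * (x (K \ Q) - ∑ z ∈ K \ Q, x ((K \ Q).erase z)) = x K := by
  -- the double sum, re-indexed by `Q' = insert z Q`
  have hdouble : ∑ Q ∈ K.powerset, ((Q.card).factorial : ℝ) * ∑ z ∈ K \ Q, x ((K \ Q).erase z) =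
      ∑ Q ∈ K.powerset.filter (fun Q => Q.Nonempty), ((Q.card).factorial : ℝ) * x (K \ Q) := by
    calc ∑ Q ∈ K.powerset, ((Q.card).factorial : ℝ) * ∑ z ∈ K \ Q, x ((K \ Q).erase z)
        = ∑ Q ∈ K.powerset, ∑ z ∈ K \ Q, ((Q.card).factorial : ℝ) * x ((K \ Q).erase z) := by
            simp only [mul_sum]
      _ = ∑ z ∈ K, ∑ Q ∈ (K.erase z).powerset, ((Q.card).factorial : ℝ) * x ((K \ Q).erase z) := by
            refine sum_comm' fun Q z => ?_
            simp only [mem_powerset, mem_sdiff]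
            constructor
            · rintro ⟨hQK, hzK, hzQ⟩
              exact ⟨fun y hy => mem_erase.2 ⟨fun h => hzQ (h ▸ hy), hQK hy⟩, hzK⟩
            · rintro ⟨hQ, hzK⟩
              exact ⟨hQ.trans (erase_subset _ _), hzK, fun h => (mem_erase.1 (hQ h)).1 rfl⟩
      _ = ∑ z ∈ K, ∑ Q ∈ (K.erase z).powerset,
            ((((insert z Q).card - 1).factorial : ℝ) * x (K \ insert z Q)) := by
            refine sum_congr rfl fun z hz => sum_congr rfl fun Q hQ => ?_
            have hzQ : z ∉ Q := fun h => (mem_erase.1 (mem_powerset.1 hQ h)).1 rfl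
            rw [card_insert_of_notMem hzQ, Nat.add_sub_cancel]
            congr 2
            ext y
            simp only [mem_erase, mem_sdiff, mem_insert, not_or]
            tauto
      _ = ∑ z ∈ K, ∑ Q ∈ K.powerset.filter (fun Q => z ∈ Q), (((Q.card - 1).factorial : ℝ) * x (K \ Q)) :=
            sum_congr rfl fun z hz =>
              sum_powerset_erase_insert K hz (fun Q => (((Q.card - 1).factorial : ℝ)) * x (K \ Q))
      _ = ∑ Q ∈ K.powerset.filter (fun Q => Q.Nonempty), ∑ z ∈ Q, (((Q.card - 1).factorial : ℝ) * x (K \ Q)) := by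
            refine sum_comm' fun z Q => ?_
            simp only [mem_filter, mem_powerset]
            constructor
            · rintro ⟨hzK, hQK, hzQ⟩; exact ⟨hzQ, hQK, ⟨z, hzQ⟩⟩
            · rintro ⟨hzQ, hQK, _⟩; exact ⟨hQK hzQ, hQK, hzQ⟩
      _ = ∑ Q ∈ K.powerset.filter (fun Q => Q.Nonempty), ((Q.card).factorial : ℝ) * x (K \ Q) := by
            refine sum_congr rfl fun Q hQ => ?_
            have hne : Q.Nonempty := (mem_filter.1 hQ).2
            rw [sum_const, nsmul_eq_mul, ← mul_assoc]
            congr 1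
            have hc : Q.card = (Q.card - 1) + 1 := (Nat.succ_pred_eq_of_pos hne.card_pos).symm
            conv_rhs => rw [hc, Nat.factorial_succ, ← hc]
            push_cast
            ring
  rw [sum_congr rfl fun Q _ => mul_sub _ _ _, sum_sub_distrib, hdouble]
  -- the single sum minus its nonempty part is the `Q = ∅` term
  rw [← sum_filter_add_sum_filter_not K.powerset (fun Q => Q.Nonempty), add_sub_cancel_left]
  have hempty : K.powerset.filter (fun Q => ¬ Q.Nonempty) = {∅} := by
    ext Q
    simp only [mem_filter, mem_powerset, not_nonempty_iff_eq_empty, mem_singleton]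
    constructor
    · rintro ⟨_, rfl⟩; rfl
    · rintro rfl; exact ⟨empty_subset _, rfl⟩
  rw [hempty, sum_singleton, card_empty, Nat.factorial_zero, sdiff_empty]
  simp

end General

end ComplementForm

end Summit.CriticalPhenomena.PercolationContinuityZ3.Theorems
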